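import Literature.MathematicalPhysics.QuantumFieldTheory.Balaban1983to89.B9Thm310Whole
import Literature.MathematicalPhysics.QuantumFieldTheory.Balaban1983to89.B9Thm312Whole
import Literature.MathematicalPhysics.QuantumFieldTheory.Balaban1983to89.B6RandomWalkKernel

/-!
# `Balaban1983to89.B9Thm311FromEq3105Schur` — T. Bałaban, *Propagators for lattice gauge theories in a background field*, Commun. Math.
# Phys. **99** (1985) 389–434 [Balaban1985BackgroundPropagators], THEOREM 3.11 p. 416 FOR `Δ_a` BY PRINT'S OWN ROAD, ON THE WALK LETTERS OF
# THEOREM 3.10: from (3.105) `Δ_a·G₀ = I − R` ∕ `G₀·Δ_a = I − R♯`, the (3.89)-type factor majorants of `R`, `R♯`, [4] (2.60)–(2.61), and the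
# LOCAL positivity «the operators G_□ are positive» — `Δ_a` is positive definite (generic member, generic real coordinates)

statement-level skeleton of published theorems with citation tags; proofs where landed; nothing here is a claim about the Yang–Mills mass gap

THE PRINT (p. 416, verbatim up to notation).  *«Theorem 3.11. Under the assumptions of the Theorems 3.1–3.10 (i.e. for M sufficiently large and α₀
sufficiently small) the operators Δ′_a, G′, (Q′G′²Q′\*)⁻¹, Δ_a, G are positive definite. … it is enough to prove it for G. It is a symmetric and
invertible operator, so if it is not positive, then there exists A₀ ≠ 0, λ₀ > 0 such that GA₀ = −λ₀A₀. By (3.106) G = G₀(I − R)⁻¹, R is an operator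
with small norm. Let us assume that the operator G₀ is positive … This is in contradiction with the inequality ⟨A,(I − R\*)A⟩ = ⟨A,A⟩ − Re⟨A,RA⟩
≥ (1 − O(M⁻¹))⟨A,A⟩ > 0 holding for M sufficiently large. Thus we have to prove the positivity of G₀. By the definition (3.87) it is enough to prove
a positivity of the operators G_□.»*; (3.105) p. 414 *«Δ_aG₀ = I − R»*; (3.87) p. 409 *«G₀ = Σ_{□∈𝒟} h_□G_□h_□»*; (3.89) p. 409 (the O(M⁻¹)
factor bound); [4] Lemma 2.1 (2.60)–(2.61) p. 234.

WHY THIS FILE (cell `pub-ymgap`, node N06 [B9], seat `pub-ymgap-dag-n06-j` g21, bundle F5 rows 15–17; count-neutral, `--supports` only).  The N06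
certificate of record displays row 17 WHOLE (`hΔA : … Reg335 … → PosDefTr 1 (deltaAY …)`), and displays SEPARATELY, inside row 19's `h36A`, the walk
letters of Theorem 3.10 with the schemas `B9Thm310Whole.Identities310` ((3.105) and its transpose: `eq3105`, `eq3105T`), `Factors389` (the block-sup
majorants `θ₀M⁻¹e^{−δ₀d}` of the factors `R_a` and the scale-weighted ones of `R♯_a`) and the static data `StaticOK310` (the factor overlap count
`cntF`).  THIS FILE runs print's p. 416 argument on exactly those letters, for ONE member and ONE configuration, in the real-coordinate currency of
the walk letters (`B9Thm312Whole.PosDefEnd`, `B9Thm37Glue.IsTransposePair`): the only input beyond the displayed schemas is print's remaining local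
statement «G_□ positive» — here `∀ i, IsTransposePair (Gsq U i) (Gsq U i) ∧ ∀ v, 0 ≤ v ⬝ᵥ Gsq U i v` (symmetric, positive SEMI-definite suffices) —
plus the symmetry of `Δ_a` and the two geometric sums.  The sequel `B9Thm311FromRow19AtLettersY` reads the conclusion back to def-Y's genuine
`deltaAY` at the record (row 17's literal body).
* §1 ★ `abs_dotProduct_le_of_hasMajorant_pair` — THE NUMERICAL RADIUS BY THE SCHUR TEST: a block majorant `K` of `T` ([4] (2.51)) and a block
  majorant `K′` of a transpose `T′` with row sums `≤ ρ`, `≤ ρ′` give `|⟨v, Tv⟩| ≤ ½(ρ + ρ′)·⟨v, v⟩` (the absolute row sums of the kernel of `T` over a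
  block are read off `K` by the sign test function — p22's `B6Ineq2140KLevelV1.rowSum_le_of_hasMajorant`, re-proved privately to keep the import
  closure light — the column sums off `K′`, then `|a|·|v_x||v_{x′}| ≤ ½|a|(v_x² + v_{x′}²)`).
* §2 ★★ `posDefEnd_of_mul_eq_one_sub_of_psd` — THE p. 416 STEP, sqrt-free and with `G₀` only positive SEMI-definite: `T` symmetric, `T·G₀ = 1 − R`,
  `⟨v, G₀v⟩ ≥ 0`, `⟨v, Rv⟩ ≤ θ⟨v, v⟩`, `θ < 1` ⇒ `T` positive definite (an eigenvector `w` of `T` with eigenvalue `λ ≤ 0` would give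
  `⟨w, TG₀w⟩ = λ⟨w, G₀w⟩ ≤ 0` against `⟨w, (1 − R)w⟩ ≥ (1 − θ)⟨w, w⟩ > 0`; the eigenvector comes from `Matrix.IsHermitian.eigenvectorBasis`).
* §3 the (3.87)∕(3.105) structure: `dotProduct_localSum_nonneg` (`G₀ = Σ_i M_{h_i}G_iM_{h_i}` is PSD when the `G_i` are), `isTransposePair_localSum`,
  `isTransposePair_one_sub_mul` (`R = 1 − Δ_aG₀` and `R♯ = 1 − G₀Δ_a` are a transpose pair when `Δ_a`, `G₀` are symmetric).
* §4 the majorants of `R = Σ_a R_a`, `R♯ = Σ_a R♯_a` and their row sums: `hasMajorant_fintype_sum`, ★ `rowSum_fac_le` (`≤ N_F·θ₀M⁻¹·c` from `cntF` and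
  (2.61) at rate `δ₀`), ★ `rowSum_facT_le` (`≤ N_F·θ₀M⁻¹·Λ·c′` — the scale factor `L^jη·(L^{j′}η)⁻¹` of `facT` absorbed by the level-gap letter
  `L^jη ≤ Λ·e^{β·d(y,y′)}·L^{j′}η` ([4] (2.60)) and (2.61) at rate `δ₀ − β`).
* §5 ★★★ `posDefEnd_deltaA_of_identities310` — Theorem 3.11 for the letter `𝔬.Δa U` of ANY `Ops310 g B X Y ι A` at ANY `U`: from `StaticOK310`,
  `Identities310 … U` (fields `eq3105`, `eq3105T` only), `Factors389 … θ₀ δ₀ U`, the symmetry of `𝔬.Δa U`, the local clause on the `𝔬.Gsq U i`, the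
  level-gap letter and the two row sums, under «M sufficiently large»: `N_F·θ₀·(c + Λ·c′) < 2M`.
HONEST SCOPE.  Finite-dimensional linear algebra and [4] (2.60)–(2.61) bookkeeping on HYPOTHESIS SCHEMAS of printed shape; Cor. 3.6's positivity of
the `G_□(U)` is NOT proved (it is the displayed local input), nor are the factor bounds (3.89)∕(3.105) (displayed in row 19); nothing of [B9]'s
estimates is asserted; one finite lattice at a time; NOT a node discharge; nothing continuum ∕ OS ∕ mass gap ∕ Clay.
-/

noncomputable section

namespace Literature.MathematicalPhysics.QuantumFieldTheory.Balaban1983to89.B9Thm311FromEq3105Schur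

open Literature.MathematicalPhysics.QuantumFieldTheory.Balaban1983to89
open Finset B6RandomWalk B9Thm34Ext B9Thm37Sum B9Thm37Glue
open Literature.MathematicalPhysics.QuantumFieldTheory.Balaban1983to89.B9Thm310Whole (Ops310 StaticOK310 Factors389 Identities310 Sizes310)
open Literature.MathematicalPhysics.QuantumFieldTheory.Balaban1983to89.B9Thm312Whole (PosDefEnd)
open Literature.MathematicalPhysics.QuantumFieldTheory.Balaban1983to89.B6RandomWalkKernel (apply_eq_sum_single)
open scoped Matrix

/-! ## §1 The numerical radius by the Schur test from a majorant of `T` and a majorant of a transpose -/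

section Schur

variable {g : B6.Geometry} {X : Type} [Fintype X] [DecidableEq X]

/-- the absolute row sum of the kernel of `T` over the block `Δ(y′)` is at most `K(y(x), y′)` — test the (2.51) majorant against the sign pattern
of the row (p22's `B6Ineq2140KLevelV1.rowSum_le_of_hasMajorant`, restated privately to keep the import closure light). [folklore] -/
private theorem rowSum_le_of_hasMajorant [DecidableEq g.Site] (blk : X → g.Site) {T : Module.End ℝ (X → ℝ)} {K : g.Site → g.Site → ℝ}
    (hT : HasMajorant blk T K) (x : X) (y' : g.Site) :
    ∑ x' ∈ univ.filter (fun x' => blk x' = y'), |T (Pi.single x' 1) x| ≤ K (blk x) y' := by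
  classical
  set μ : X → ℝ := fun x' => if blk x' = y' then (if 0 ≤ T (Pi.single x' 1) x then 1 else -1) else 0 with hμ
  have hμ_in : ∀ x', blk x' = y' → μ x' * T (Pi.single x' 1) x = |T (Pi.single x' 1) x| ∧ |μ x'| ≤ 1 := by
    intro x' hx'
    by_cases h0 : 0 ≤ T (Pi.single x' 1) x
    · have hval : μ x' = 1 := by simp only [hμ, hx', h0, if_true]
      rw [hval, one_mul, abs_of_nonneg h0, abs_one]
      exact ⟨rfl, le_rfl⟩
    · have hval : μ x' = -1 := by simp only [hμ, hx', h0, if_true, if_false]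
      rw [hval, neg_one_mul, abs_of_neg (lt_of_not_ge h0), abs_neg, abs_one]
      exact ⟨rfl, le_rfl⟩
  have hμ_out : ∀ x', blk x' ≠ y' → μ x' = 0 := fun x' hx' => by simp only [hμ, hx', if_false]
  have hsupp : BlockSupp blk μ y' 1 := ⟨zero_le_one, fun x' hx' => (hμ_in x' hx').2, hμ_out⟩
  have h := hT y' μ 1 hsupp x
  rw [mul_one] at h
  have hexp : T μ x = ∑ x' ∈ univ.filter (fun x' => blk x' = y'), |T (Pi.single x' 1) x| := by
    rw [apply_eq_sum_single, Finset.sum_filter]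
    refine Finset.sum_congr rfl fun x' _ => ?_
    by_cases hx' : blk x' = y'
    · rw [if_pos hx', (hμ_in x' hx').1]
    · rw [if_neg hx', hμ_out x' hx', zero_mul]
  rw [← hexp]
  exact (le_abs_self _).trans h

/-- the full absolute row sum of the kernel of `T` is at most the row sum of the majorant: `Σ_{x′} |T(x, x′)| ≤ Σ_{y′} K(y(x), y′)`.
[cite: Balaban1984PropagatorsII, (2.51)–(2.52) p.232 (operators and their block majorants; derivation ours)] -/
theorem absRowSum_le_of_hasMajorant (blk : X → g.Site) {T : Module.End ℝ (X → ℝ)}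
    {K : g.Site → g.Site → ℝ} (hT : HasMajorant blk T K) (x : X) :
    ∑ x', |T (Pi.single x' 1) x| ≤ ∑ y', K (blk x) y' := by
  classical
  rw [← Finset.sum_fiberwise univ blk (fun x' => |T (Pi.single x' 1) x|)]
  exact Finset.sum_le_sum fun y' _ => rowSum_le_of_hasMajorant blk hT x y'

/-- on singles, a transpose pair reads `T′(δ_x)(x′) = T(δ_{x′})(x)` — the kernel of `T′` is the transposed kernel of `T`. [folklore] -/
private theorem transpose_single {T T' : Module.End ℝ (X → ℝ)} (htr : IsTransposePair T T') (x x' : X) :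
    T' (Pi.single x 1) x' = T (Pi.single x' 1) x := by
  have h := htr (Pi.single x' 1) (Pi.single x 1)
  have hL : ∑ y, T (Pi.single x' 1) y * (Pi.single x (1 : ℝ) : X → ℝ) y = T (Pi.single x' 1) x := by
    rw [Fintype.sum_eq_single x (fun y hy => by rw [Pi.single_eq_of_ne hy, mul_zero]), Pi.single_eq_same, mul_one]
  have hR : ∑ y, (Pi.single x' (1 : ℝ) : X → ℝ) y * T' (Pi.single x 1) y = T' (Pi.single x 1) x' := by
    rw [Fintype.sum_eq_single x' (fun y hy => by rw [Pi.single_eq_of_ne hy, zero_mul]), Pi.single_eq_same, one_mul]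
  rw [hL, hR] at h
  exact h.symm

/-- ★ **THE NUMERICAL RADIUS BY THE SCHUR TEST**: a block majorant `K` of `T` and a block majorant `K′` of a transpose `T′` of `T`, with row sums
`Σ_{y′} K(y, y′) ≤ ρ` and `Σ_{y′} K′(y, y′) ≤ ρ′`, give `|⟨v, Tv⟩| ≤ ½(ρ + ρ′)·⟨v, v⟩` for the component pairing — the `L²` reading of «R is an
operator with small norm» that print's p. 416 inequality `⟨A,A⟩ − Re⟨A,RA⟩ ≥ (1 − O(M⁻¹))⟨A,A⟩` uses.
[cite: Balaban1985BackgroundPropagators, Thm 3.11 proof p.416; Balaban1984PropagatorsII, (2.51) p.232 (majorants; Schur test ours)] -/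
theorem abs_dotProduct_le_of_hasMajorant_pair (blk : X → g.Site) {T T' : Module.End ℝ (X → ℝ)}
    {K K' : g.Site → g.Site → ℝ} (hT : HasMajorant blk T K) (hT' : HasMajorant blk T' K') (htr : IsTransposePair T T')
    {ρ ρ' : ℝ} (hrow : ∀ x : X, ∑ y', K (blk x) y' ≤ ρ) (hrow' : ∀ x : X, ∑ y', K' (blk x) y' ≤ ρ') (v : X → ℝ) :
    |v ⬝ᵥ T v| ≤ (ρ + ρ') / 2 * (v ⬝ᵥ v) := by
  -- the kernel `a x x′ = T(δ_{x′})(x)`; its absolute row sums are `≤ ρ`, its absolute column sums `≤ ρ′`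
  set a : X → X → ℝ := fun x x' => T (Pi.single x' 1) x with ha
  have hrowa : ∀ x, ∑ x', |a x x'| ≤ ρ := fun x => (absRowSum_le_of_hasMajorant blk hT x).trans (hrow x)
  have hcola : ∀ x', ∑ x, |a x x'| ≤ ρ' := by
    intro x'
    have h1 : ∑ x, |a x x'| = ∑ x, |T' (Pi.single x 1) x'| :=
      Finset.sum_congr rfl fun x _ => by rw [ha, transpose_single htr x x']
    rw [h1]
    exact (absRowSum_le_of_hasMajorant blk hT' x').trans (hrow' x')
  -- `⟨v, Tv⟩ = Σ_x Σ_{x′} v_x a_{x x′} v_{x′}`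
  have hform : v ⬝ᵥ T v = ∑ x, ∑ x', v x * (a x x' * v x') := by
    unfold dotProduct
    refine Finset.sum_congr rfl fun x _ => ?_
    rw [apply_eq_sum_single T v x, Finset.mul_sum]
    exact Finset.sum_congr rfl fun x' _ => by rw [ha]; ring
  -- `|v_x a v_{x′}| ≤ ½|a|(v_x² + v_{x′}²)`
  have hpt : ∀ x x', |v x * (a x x' * v x')| ≤ |a x x'| * (v x ^ 2 + v x' ^ 2) / 2 := by
    intro x x'
    rw [abs_mul, abs_mul]
    have h2 : |v x| * |v x'| ≤ (v x ^ 2 + v x' ^ 2) / 2 := by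
      have h0 : 0 ≤ (|v x| - |v x'|) ^ 2 := sq_nonneg _
      have h3 : (|v x| - |v x'|) ^ 2 = v x ^ 2 + v x' ^ 2 - 2 * (|v x| * |v x'|) := by
        rw [sub_sq, sq_abs, sq_abs]; ring
      linarith
    calc |v x| * (|a x x'| * |v x'|) = |a x x'| * (|v x| * |v x'|) := by ring
      _ ≤ |a x x'| * ((v x ^ 2 + v x' ^ 2) / 2) := mul_le_mul_of_nonneg_left h2 (abs_nonneg _)
      _ = |a x x'| * (v x ^ 2 + v x' ^ 2) / 2 := by ring
  have hvv : v ⬝ᵥ v = ∑ x, v x ^ 2 := by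
    unfold dotProduct
    exact Finset.sum_congr rfl fun x _ => by ring
  calc |v ⬝ᵥ T v| = |∑ x, ∑ x', v x * (a x x' * v x')| := by rw [hform]
    _ ≤ ∑ x, ∑ x', |v x * (a x x' * v x')| :=
        (Finset.abs_sum_le_sum_abs _ _).trans (Finset.sum_le_sum fun x _ => Finset.abs_sum_le_sum_abs _ _)
    _ ≤ ∑ x, ∑ x', |a x x'| * (v x ^ 2 + v x' ^ 2) / 2 :=
        Finset.sum_le_sum fun x _ => Finset.sum_le_sum fun x' _ => hpt x x'
    _ = (∑ x, v x ^ 2 * ∑ x', |a x x'|) / 2 + (∑ x', v x' ^ 2 * ∑ x, |a x x'|) / 2 := by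
        have h1 : ∑ x, ∑ x', |a x x'| * (v x ^ 2 + v x' ^ 2) / 2 =
            ∑ x, ∑ x', |a x x'| * v x ^ 2 / 2 + ∑ x, ∑ x', |a x x'| * v x' ^ 2 / 2 := by
          rw [← Finset.sum_add_distrib]
          refine Finset.sum_congr rfl fun x _ => ?_
          rw [← Finset.sum_add_distrib]
          exact Finset.sum_congr rfl fun x' _ => by ring
        rw [h1]
        congr 1
        · rw [Finset.sum_div]
          refine Finset.sum_congr rfl fun x _ => ?_
          rw [Finset.mul_sum, Finset.sum_div]
          exact Finset.sum_congr rfl fun x' _ => by ring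
        · rw [Finset.sum_comm, Finset.sum_div]
          refine Finset.sum_congr rfl fun x' _ => ?_
          rw [Finset.mul_sum, Finset.sum_div]
          exact Finset.sum_congr rfl fun x _ => by ring
    _ ≤ (∑ x, v x ^ 2 * ρ) / 2 + (∑ x', v x' ^ 2 * ρ') / 2 := by
        gcongr with x _ x' _
        · exact hrowa x
        · exact hcola x'
    _ = (ρ + ρ') / 2 * (v ⬝ᵥ v) := by
        rw [hvv, ← Finset.sum_mul, ← Finset.sum_mul]
        ring

end Schur

/-! ## §2 The p. 416 step: positivity of a symmetric `T` from `T·G₀ = 1 − R`, `G₀ ≥ 0`, `R` small -/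

section Engine

variable {X : Type} [Fintype X]

/-- the form of a transpose pair moves across: `⟨Tu, v⟩ = ⟨u, T′v⟩` for the component pairing. [folklore] -/
private theorem dotProduct_apply_left {T T' : Module.End ℝ (X → ℝ)} (htr : IsTransposePair T T') (u v : X → ℝ) :
    T u ⬝ᵥ v = u ⬝ᵥ T' v := htr u v

/-- ★★ **THE p. 416 STEP, sqrt-free, with `G₀` only positive SEMI-definite**: a symmetric `T` on a finite real function lattice with
`T·G₀ = 1 − R`, `⟨v, G₀v⟩ ≥ 0` for all `v`, and `⟨v, Rv⟩ ≤ θ⟨v, v⟩` with `θ < 1`, is positive definite.  (Print: *«if it is not positive, then there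
exists A₀ ≠ 0, λ₀ > 0 such that GA₀ = −λ₀A₀ … This is in contradiction with the inequality ⟨A,(I − R\*)A⟩ = ⟨A,A⟩ − Re⟨A,RA⟩ ≥ (1 − O(M⁻¹))⟨A,A⟩ >
0»*; here the eigenvector is one of `T` itself: `⟨w, TG₀w⟩ = λ⟨w, G₀w⟩ ≤ 0` against `⟨w, (1 − R)w⟩ ≥ (1 − θ)⟨w, w⟩ > 0`, so no square root of `G₀`
and no invertibility are needed.) [cite: Balaban1985BackgroundPropagators, Thm 3.11 proof p.416, (3.105)–(3.106) p.414] -/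
theorem posDefEnd_of_mul_eq_one_sub_of_psd [DecidableEq X] {T G₀ R : Module.End ℝ (X → ℝ)} (hT : IsTransposePair T T) (hfac : T * G₀ = 1 - R)
    (hG₀ : ∀ v : X → ℝ, 0 ≤ v ⬝ᵥ G₀ v) {θ : ℝ} (hθ : θ < 1) (hR : ∀ v : X → ℝ, v ⬝ᵥ R v ≤ θ * (v ⬝ᵥ v)) :
    PosDefEnd T := by
  classical
  -- the matrix of `T` is real symmetric
  set A : Matrix X X ℝ := LinearMap.toMatrix' T with hAdef
  have hTA : ∀ v : X → ℝ, T v = A *ᵥ v := fun v => by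
    conv_lhs => rw [← Matrix.toLin'_toMatrix' T]
    rw [Matrix.toLin'_apply]
  have hA : A.IsHermitian := by
    refine Matrix.IsHermitian.ext fun i j => ?_
    rw [star_trivial, hAdef, LinearMap.toMatrix'_apply, LinearMap.toMatrix'_apply]
    exact (transpose_single hT j i).symm ▸ rfl
  -- every eigenvalue is positive: an eigenvector with eigenvalue `λ ≤ 0` contradicts the smallness of `R`
  have hpos : ∀ j, 0 < hA.eigenvalues j := by
    intro j
    by_contra hle
    push Not at hle
    set w : X → ℝ := ⇑(hA.eigenvectorBasis j) with hw
    have hw0 : w ≠ 0 := by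
      intro h
      have h1 : ‖hA.eigenvectorBasis j‖ = 1 := hA.eigenvectorBasis.orthonormal.1 j
      have h2 : hA.eigenvectorBasis j = 0 := (WithLp.ofLp_eq_zero 2).mp h
      rw [h2, norm_zero] at h1
      exact zero_ne_one h1
    have hTw : T w = hA.eigenvalues j • w := by rw [hTA, hw, hA.mulVec_eigenvectorBasis j]
    -- `⟨w, T(G₀w)⟩ = ⟨Tw, G₀w⟩ = λ⟨w, G₀w⟩ ≤ 0`
    have h1 : w ⬝ᵥ T (G₀ w) = hA.eigenvalues j * (w ⬝ᵥ G₀ w) := by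
      rw [← dotProduct_apply_left hT, hTw, smul_dotProduct, smul_eq_mul]
    have h2 : w ⬝ᵥ T (G₀ w) ≤ 0 := by
      rw [h1]
      exact mul_nonpos_of_nonpos_of_nonneg hle (hG₀ w)
    -- `⟨w, T(G₀w)⟩ = ⟨w, w⟩ − ⟨w, Rw⟩ ≥ (1 − θ)⟨w, w⟩ > 0`
    have h3 : w ⬝ᵥ T (G₀ w) = w ⬝ᵥ w - w ⬝ᵥ R w := by
      rw [← Module.End.mul_apply, hfac, LinearMap.sub_apply, Module.End.one_apply, dotProduct_sub]
    have hww : 0 < w ⬝ᵥ w := by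
      have h := (Matrix.dotProduct_star_self_pos_iff).mpr hw0
      rwa [star_trivial] at h
    have h4 : (1 - θ) * (w ⬝ᵥ w) ≤ w ⬝ᵥ T (G₀ w) := by
      rw [h3]
      have := hR w
      linarith
    have h5 : 0 < (1 - θ) * (w ⬝ᵥ w) := mul_pos (by linarith) hww
    linarith
  have hPD : A.PosDef := (hA.posDef_iff_eigenvalues_pos).mpr hpos
  intro f hf
  have h := hPD.dotProduct_mulVec_pos hf
  rw [star_trivial, ← hTA] at h
  exact h

end Engine

/-! ## §3 The structure of (3.87) and (3.105): `G₀ = Σ_i M_{h_i}G_iM_{h_i}`, `R = 1 − Δ_aG₀`, `R♯ = 1 − G₀Δ_a` -/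

section Structure

variable {X : Type} [Fintype X]

/-- `M_h` moves across the component pairing: `⟨M_h u, v⟩ = ⟨u, M_h v⟩`. [folklore] -/
private theorem dotProduct_mulOp (h u v : X → ℝ) : mulOp h u ⬝ᵥ v = u ⬝ᵥ mulOp h v := by
  unfold dotProduct
  exact Finset.sum_congr rfl fun x _ => by rw [mulOp_apply, mulOp_apply]; ring

/-- **`G₀ = Σ_i M_{h_i}G_iM_{h_i}` IS POSITIVE SEMI-DEFINITE WHEN THE `G_i` ARE**: `⟨v, G₀v⟩ = Σ_i ⟨h_iv, G_i(h_iv)⟩ ≥ 0` (p. 416: *«By the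
definition (3.87) it is enough to prove a positivity of the operators G_□»*). [cite: Balaban1985BackgroundPropagators, Thm 3.11 proof p.416 + (3.87) p.409] -/
theorem dotProduct_localSum_nonneg {ι : Type} [Fintype ι] (h : ι → X → ℝ) (Gl : ι → Module.End ℝ (X → ℝ))
    (hGl : ∀ i (v : X → ℝ), 0 ≤ v ⬝ᵥ Gl i v) (v : X → ℝ) :
    0 ≤ v ⬝ᵥ (∑ i, mulOp (h i) * Gl i * mulOp (h i)) v := by
  rw [LinearMap.sum_apply, dotProduct_sum]
  refine Finset.sum_nonneg fun i _ => ?_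
  rw [Module.End.mul_apply, Module.End.mul_apply, ← dotProduct_mulOp]
  exact hGl i _

/-- `G₀ = Σ_i M_{h_i}G_iM_{h_i}` is symmetric when the `G_i` are (p. 416: *«It is a symmetric … operator»*).
[cite: Balaban1985BackgroundPropagators, Thm 3.11 proof p.416 + (3.87) p.409] -/
theorem isTransposePair_localSum {ι : Type} [Fintype ι] (h : ι → X → ℝ) (Gl : ι → Module.End ℝ (X → ℝ))
    (hGl : ∀ i, IsTransposePair (Gl i) (Gl i)) :
    IsTransposePair (∑ i, mulOp (h i) * Gl i * mulOp (h i)) (∑ i, mulOp (h i) * Gl i * mulOp (h i)) :=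
  IsTransposePair.sum fun i => ((isTransposePair_mulOp (h i)).mul (hGl i)).mul (isTransposePair_mulOp (h i))

/-- **`R = 1 − Δ_aG₀` AND `R♯ = 1 − G₀Δ_a` ARE A TRANSPOSE PAIR** when `Δ_a` and `G₀` are symmetric (print: *«R\*»*; the glue's `eq3105` ∕
`eq3105T`). [cite: Balaban1985BackgroundPropagators, Thm 3.11 proof p.416 + (3.105) p.414] -/
theorem isTransposePair_one_sub_mul {T G₀ R Rt : Module.End ℝ (X → ℝ)} (hT : IsTransposePair T T) (hG₀ : IsTransposePair G₀ G₀)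
    (h105 : T * G₀ = 1 - R) (h105T : G₀ * T = 1 - Rt) : IsTransposePair R Rt := by
  have hR : R = 1 - T * G₀ := by rw [h105, sub_sub_cancel]
  have hRt : Rt = 1 - G₀ * T := by rw [h105T, sub_sub_cancel]
  rw [hR, hRt]
  exact isTransposePair_one.sub (hT.mul hG₀)

end Structure

/-! ## §4 The majorants of `R = Σ_a R_a`, `R♯ = Σ_a R♯_a` and their row sums -/

section RowSums

variable {g : B6.Geometry} {X : Type}

/-- majorants add over a finite index type (p. 232: *«A summation preserves it also»*). [cite: Balaban1984PropagatorsII, (2.52) p.232] -/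
theorem hasMajorant_fintype_sum (blk : X → g.Site) {A : Type} [Fintype A] {T : A → Module.End ℝ (X → ℝ)}
    {K : A → g.Site → g.Site → ℝ} (h : ∀ a, HasMajorant blk (T a) (K a)) :
    HasMajorant blk (∑ a, T a) (fun y y' => ∑ a, K a y y') := by
  classical
  have key : ∀ s : Finset A, HasMajorant blk (∑ a ∈ s, T a) (fun y y' => ∑ a ∈ s, K a y y') := by
    intro s
    induction s using Finset.induction_on with
    | empty =>
        simp only [Finset.sum_empty]
        exact hasMajorant_zero blk
    | insert a s ha ih =>
        simp only [Finset.sum_insert ha]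
        exact hasMajorant_add blk (h a) ih
  exact key univ

end RowSums

section RowSums310

variable {g : B9.Geometry} [Fintype g.Site] [DecidableEq g.Site] {B : B9.Backgrounds}
variable {X Y ι A : Type} [Fintype ι] [Fintype A]

/-- ★ **THE ROW SUMS OF THE MAJORANT OF `R = Σ_a R_a`**: with `Σ_a 1_{y ∈ X_a∩𝔅} ≤ N_F` (`StaticOK310.cntF`) and the (2.61) row sum
`Σ_{y′} e^{−δ₀d(y,y′)} ≤ c`, `Σ_{y′} Σ_a 1_{y∈X_a}θ₀M⁻¹e^{−δ₀d(y,y′)} ≤ N_F·θ₀M⁻¹·c`. [cite: Balaban1985BackgroundPropagators, (3.89) p.409 + p.413 («very small families»); Balaban1984PropagatorsII, Lemma 2.1 (2.61) p.234] -/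
theorem rowSum_fac_le (𝔬 : Ops310 g B X Y ι A) {ρ N N' NF Cℓ : ℝ} {κ : Sizes310} (hs : StaticOK310 𝔬 ρ N N' NF Cℓ κ)
    {θ₀ δ₀ c : ℝ} (hθ₀ : 0 ≤ θ₀) (hM : 0 < g.M) (hrow : ∀ y : g.Site, ∑ y', Real.exp (-(δ₀ * g.dist y y')) ≤ c) (y : g.Site) :
    ∑ y', ∑ a : A, (if y ∈ 𝔬.SF a then θ₀ * g.M⁻¹ * Real.exp (-(δ₀ * g.dist y y')) else 0) ≤ NF * (θ₀ * g.M⁻¹) * c := by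
  have hθM : 0 ≤ θ₀ * g.M⁻¹ := mul_nonneg hθ₀ (inv_nonneg.mpr hM.le)
  have hNF : (∑ a : A, if y ∈ 𝔬.SF a then (1 : ℝ) else 0) ≤ NF := hs.cntF y
  have h1 : ∀ y', ∑ a : A, (if y ∈ 𝔬.SF a then θ₀ * g.M⁻¹ * Real.exp (-(δ₀ * g.dist y y')) else 0) =
      (∑ a : A, if y ∈ 𝔬.SF a then (1 : ℝ) else 0) * (θ₀ * g.M⁻¹ * Real.exp (-(δ₀ * g.dist y y'))) := by
    intro y'
    rw [Finset.sum_mul]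
    exact Finset.sum_congr rfl fun a _ => by by_cases hy : y ∈ 𝔬.SF a <;> simp [hy]
  calc ∑ y', ∑ a : A, (if y ∈ 𝔬.SF a then θ₀ * g.M⁻¹ * Real.exp (-(δ₀ * g.dist y y')) else 0)
      = (∑ a : A, if y ∈ 𝔬.SF a then (1 : ℝ) else 0) * ((θ₀ * g.M⁻¹) * ∑ y', Real.exp (-(δ₀ * g.dist y y'))) := by
        rw [Finset.mul_sum, Finset.mul_sum]
        exact Finset.sum_congr rfl fun y' _ => by rw [h1 y']
    _ ≤ NF * ((θ₀ * g.M⁻¹) * c) := by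
        have hS : 0 ≤ ∑ y', Real.exp (-(δ₀ * g.dist y y')) := Finset.sum_nonneg fun _ _ => (Real.exp_pos _).le
        have hcnt : 0 ≤ ∑ a : A, if y ∈ 𝔬.SF a then (1 : ℝ) else 0 :=
          Finset.sum_nonneg fun _ _ => by split_ifs <;> norm_num
        exact mul_le_mul hNF (mul_le_mul_of_nonneg_left (hrow y) hθM) (mul_nonneg hθM hS) ((hcnt.trans hNF))
    _ = NF * (θ₀ * g.M⁻¹) * c := by ring

/-- ★ **THE ROW SUMS OF THE MAJORANT OF `R♯ = Σ_a R♯_a`** (the transposed factors carry *«an additional power of L^jη»*, p. 413): with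
`Σ_a 1_{y′ ∈ X_a∩𝔅} ≤ N_F`, the level-gap letter `L^jη ≤ Λ·e^{β·d(y,y′)}·L^{j′}η` ([4] (2.60)) and the (2.61) row sum at rate `δ₀ − β`,
`Σ_{y′} Σ_a 1_{y′∈X_a}·θ₀M⁻¹·(L^jη·(L^{j′}η)⁻¹)·e^{−δ₀d(y,y′)} ≤ N_F·θ₀M⁻¹·Λ·c′`.
[cite: Balaban1985BackgroundPropagators, (3.89) p.409 + p.413; Balaban1984PropagatorsII, Lemma 2.1 (2.60)–(2.61) p.234] -/
theorem rowSum_facT_le (𝔬 : Ops310 g B X Y ι A) {ρ N N' NF Cℓ : ℝ} {κ : Sizes310} (hs : StaticOK310 𝔬 ρ N N' NF Cℓ κ)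
    {θ₀ δ₀ β Λ c' : ℝ} (hθ₀ : 0 ≤ θ₀) (hM : 0 < g.M) (hΛ : 0 ≤ Λ)
    (hlen : ∀ y y' : g.Site, g.len y ≤ Λ * Real.exp (β * g.dist y y') * g.len y')
    (hrow' : ∀ y : g.Site, ∑ y', Real.exp (-((δ₀ - β) * g.dist y y')) ≤ c') (y : g.Site) :
    ∑ y', ∑ a : A, (if y' ∈ 𝔬.SF a then (1 : ℝ) else 0) * (θ₀ * g.M⁻¹) * (g.len y * (g.len y')⁻¹) *
        Real.exp (-(δ₀ * g.dist y y')) ≤ NF * (θ₀ * g.M⁻¹) * Λ * c' := by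
  have hθM : 0 ≤ θ₀ * g.M⁻¹ := mul_nonneg hθ₀ (inv_nonneg.mpr hM.le)
  -- the scale factor against the level gap: `len y · (len y′)⁻¹ · e^{−δ₀d} ≤ Λ · e^{−(δ₀−β)d}`
  have hratio : ∀ y', g.len y * (g.len y')⁻¹ * Real.exp (-(δ₀ * g.dist y y')) ≤ Λ * Real.exp (-((δ₀ - β) * g.dist y y')) := by
    intro y'
    have hl' : 0 < g.len y' := hs.lenpos y'
    have h1 : g.len y * (g.len y')⁻¹ ≤ Λ * Real.exp (β * g.dist y y') := by
      rw [mul_inv_le_iff₀ hl']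
      exact hlen y y'
    calc g.len y * (g.len y')⁻¹ * Real.exp (-(δ₀ * g.dist y y'))
        ≤ Λ * Real.exp (β * g.dist y y') * Real.exp (-(δ₀ * g.dist y y')) :=
          mul_le_mul_of_nonneg_right h1 (Real.exp_pos _).le
      _ = Λ * Real.exp (-((δ₀ - β) * g.dist y y')) := by
          rw [mul_assoc, ← Real.exp_add]
          congr 2
          ring
  have hcnt : ∀ y', 0 ≤ ∑ a : A, (if y' ∈ 𝔬.SF a then (1 : ℝ) else 0) := fun y' =>
    Finset.sum_nonneg fun _ _ => by split_ifs <;> norm_num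
  have h0 : ∀ y', ∑ a : A, (if y' ∈ 𝔬.SF a then (1 : ℝ) else 0) * (θ₀ * g.M⁻¹) * (g.len y * (g.len y')⁻¹) *
        Real.exp (-(δ₀ * g.dist y y')) =
      (∑ a : A, if y' ∈ 𝔬.SF a then (1 : ℝ) else 0) * ((θ₀ * g.M⁻¹) * (g.len y * (g.len y')⁻¹ * Real.exp (-(δ₀ * g.dist y y')))) := by
    intro y'
    rw [Finset.sum_mul]
    exact Finset.sum_congr rfl fun a _ => by ring
  have h1 : ∀ y', ∑ a : A, (if y' ∈ 𝔬.SF a then (1 : ℝ) else 0) * (θ₀ * g.M⁻¹) * (g.len y * (g.len y')⁻¹) *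
        Real.exp (-(δ₀ * g.dist y y')) ≤ NF * (θ₀ * g.M⁻¹) * (Λ * Real.exp (-((δ₀ - β) * g.dist y y'))) := by
    intro y'
    rw [h0 y', mul_assoc NF]
    refine mul_le_mul (hs.cntF y') (mul_le_mul_of_nonneg_left (hratio y') hθM) (mul_nonneg hθM ?_) ((hcnt y').trans (hs.cntF y'))
    exact mul_nonneg (mul_nonneg (hs.lenpos y).le (inv_nonneg.mpr (hs.lenpos y').le)) (Real.exp_pos _).le
  calc ∑ y', ∑ a : A, (if y' ∈ 𝔬.SF a then (1 : ℝ) else 0) * (θ₀ * g.M⁻¹) * (g.len y * (g.len y')⁻¹) *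
          Real.exp (-(δ₀ * g.dist y y'))
      ≤ ∑ y', NF * (θ₀ * g.M⁻¹) * (Λ * Real.exp (-((δ₀ - β) * g.dist y y'))) := Finset.sum_le_sum fun y' _ => h1 y'
    _ = NF * (θ₀ * g.M⁻¹) * Λ * ∑ y', Real.exp (-((δ₀ - β) * g.dist y y')) := by
        rw [Finset.mul_sum]
        exact Finset.sum_congr rfl fun y' _ => by ring
    _ ≤ NF * (θ₀ * g.M⁻¹) * Λ * c' := by
        have hNF : 0 ≤ NF := (hcnt y).trans (hs.cntF y)
        exact mul_le_mul_of_nonneg_left (hrow' y) (mul_nonneg (mul_nonneg hNF hθM) hΛ)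

end RowSums310

/-! ## §5 ★★★ Theorem 3.11 for the letter `Δ_a` of the walk letters, one member and one configuration -/

section Main

variable {g : B9.Geometry} [Fintype g.Site] [DecidableEq g.Site] {B : B9.Backgrounds}
variable {X Y ι A : Type} [Fintype X] [DecidableEq X] [Fintype ι] [Fintype A]

/-- ★★★ **THEOREM 3.11 FOR `Δ_a` ON THE WALK LETTERS OF THEOREM 3.10, ONE MEMBER, ONE `U`** — print's p. 416 proof verbatim: from the static data
(`StaticOK310`: the factor overlap count `N_F`, `L^jη > 0`, `d ≥ 0`), the structure of the expansion at `U` (`Identities310`: (3.105) `Δ_a·G₀ = 1 − Σ_aR_a`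
and its transpose `G₀·Δ_a = 1 − Σ_aR♯_a`, `G₀ = Σ_i M_{h_i}G_iM_{h_i}`), the (3.89)-type factor majorants (`Factors389 … θ₀ δ₀ U`), the symmetry of
`Δ_a(U)`, the LOCAL input «the operators G_□(U) are symmetric and positive» (positive semi-definite suffices), the level-gap letter
`L^jη ≤ Λe^{βd(y,y′)}L^{j′}η` ([4] (2.60)) and the (2.61) row sums at the rates `δ₀` and `δ₀ − β`, for «M sufficiently large»
(`N_F·θ₀·(c + Λc′) < 2M`): `Δ_a(U)` is positive definite (`B9Thm312Whole.PosDefEnd`).  The smallness `⟨v, Rv⟩ ≤ ½N_Fθ₀M⁻¹(c + Λc′)·⟨v, v⟩` is §1's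
Schur reading of the majorants of `R` and `R♯`. [cite: Balaban1985BackgroundPropagators, Thm 3.11 p.416 (statement and proof) + (3.105) p.414 + (3.87), (3.89) p.409; Balaban1984PropagatorsII, Lemma 2.1 (2.60)–(2.61) p.234, (2.51) p.232] -/
theorem posDefEnd_deltaA_of_identities310 (𝔬 : Ops310 g B X Y ι A) {Rg : ℝ} {H : Prop} {ρ N N' NF Cℓ : ℝ} {κ : Sizes310}
    (U : B.Cfg) (hs : StaticOK310 𝔬 ρ N N' NF Cℓ κ) (hI : Identities310 𝔬 Rg H U) {θ₀ δ₀ : ℝ} (hF : Factors389 𝔬 Rg H θ₀ δ₀ U)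
    (hθ₀ : 0 ≤ θ₀) (hM : 0 < g.M) {β Λ c c' : ℝ} (hΛ : 0 ≤ Λ)
    (hlen : ∀ y y' : g.Site, g.len y ≤ Λ * Real.exp (β * g.dist y y') * g.len y')
    (hrow : ∀ y : g.Site, ∑ y', Real.exp (-(δ₀ * g.dist y y')) ≤ c)
    (hrow' : ∀ y : g.Site, ∑ y', Real.exp (-((δ₀ - β) * g.dist y y')) ≤ c')
    (hbig : NF * θ₀ * (c + Λ * c') < 2 * g.M)
    (hΔa : IsTransposePair (𝔬.Δa U) (𝔬.Δa U))
    (hGsq : ∀ i, IsTransposePair (𝔬.Gsq U i) (𝔬.Gsq U i)) (hGsq0 : ∀ i (v : X → ℝ), 0 ≤ v ⬝ᵥ 𝔬.Gsq U i v) :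
    PosDefEnd (𝔬.Δa U) := by
  haveI : DecidableEq (toB6 g Rg H).Site := inferInstanceAs (DecidableEq g.Site)
  -- G₀, R, R♯
  set G₀ : Module.End ℝ (X → ℝ) := ∑ i, mulOp (𝔬.h i) * 𝔬.Gsq U i * mulOp (𝔬.h i) with hG₀
  have hG₀t : IsTransposePair G₀ G₀ := isTransposePair_localSum 𝔬.h (𝔬.Gsq U) hGsq
  have hG₀nn : ∀ v : X → ℝ, 0 ≤ v ⬝ᵥ G₀ v := dotProduct_localSum_nonneg 𝔬.h (𝔬.Gsq U) hGsq0
  have h105 : 𝔬.Δa U * G₀ = 1 - ∑ a, 𝔬.Rf U a := hI.eq3105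
  have h105T : G₀ * 𝔬.Δa U = 1 - ∑ a, 𝔬.Rt U a := hI.eq3105T
  have hRt : IsTransposePair (∑ a, 𝔬.Rf U a) (∑ a, 𝔬.Rt U a) := isTransposePair_one_sub_mul hΔa hG₀t h105 h105T
  -- the majorants of R and R♯
  have hKR : HasMajorant (g := toB6 g Rg H) 𝔬.blk (∑ a, 𝔬.Rf U a)
      (fun y y' => ∑ a : A, (if y ∈ 𝔬.SF a then θ₀ * g.M⁻¹ * Real.exp (-(δ₀ * g.dist y y')) else 0)) :=
    hasMajorant_fintype_sum (g := toB6 g Rg H) 𝔬.blk hF.fac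
  have hKRt : HasMajorant (g := toB6 g Rg H) 𝔬.blk (∑ a, 𝔬.Rt U a)
      (fun y y' => ∑ a : A, (if y' ∈ 𝔬.SF a then (1 : ℝ) else 0) * (θ₀ * g.M⁻¹) * (g.len y * (g.len y')⁻¹) *
        Real.exp (-(δ₀ * g.dist y y'))) :=
    hasMajorant_fintype_sum (g := toB6 g Rg H) 𝔬.blk hF.facT
  -- the numerical radius of R
  have hnum : ∀ v : X → ℝ, v ⬝ᵥ (∑ a, 𝔬.Rf U a) v ≤ (NF * (θ₀ * g.M⁻¹) * c + NF * (θ₀ * g.M⁻¹) * Λ * c') / 2 * (v ⬝ᵥ v) :=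
    fun v => (le_abs_self _).trans
      (abs_dotProduct_le_of_hasMajorant_pair (g := toB6 g Rg H) 𝔬.blk hKR hKRt hRt
        (fun x => rowSum_fac_le 𝔬 hs hθ₀ hM hrow (𝔬.blk x))
        (fun x => rowSum_facT_le 𝔬 hs hθ₀ hM hΛ hlen hrow' (𝔬.blk x)) v)
  -- «M sufficiently large»: the radius is < 1
  have hθ : (NF * (θ₀ * g.M⁻¹) * c + NF * (θ₀ * g.M⁻¹) * Λ * c') / 2 < 1 := by
    have h1 : (NF * (θ₀ * g.M⁻¹) * c + NF * (θ₀ * g.M⁻¹) * Λ * c') / 2 = NF * θ₀ * (c + Λ * c') / (2 * g.M) := by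
      field_simp
    rw [h1, div_lt_one (by linarith)]
    exact hbig
  exact posDefEnd_of_mul_eq_one_sub_of_psd hΔa h105 hG₀nn hθ hnum

end Main

/-! ## §6 (v1.1) The local clause by print's road: (3.86) and «the same reasoning as above» -/

section LocalClause

variable {X : Type} [Fintype X] [DecidableEq X]

/-- ★★ **POSITIVITY UNDER A SMALL PERTURBATION OF THE OPERATOR** — print's p. 416 last step for the local propagators (*«by (3.86) we get G_□(e^{iηA}) =
G_□(1)(I − V(A)G_□(1))⁻¹. In [4] we have proved that the operator G_□(1) is positive, hence by the same reasoning as above we prove positivity of G_□»*),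
made generic: a symmetric `T₁` is positive definite as soon as some `T₀` has a positive semi-definite right inverse `G₀` (`T₀·G₀ = 1`) with
`−⟨v, (T₁ − T₀)G₀v⟩ ≤ θ⟨v, v⟩`, `θ < 1` (then `T₁·G₀ = 1 − R`, `R = −(T₁ − T₀)G₀`, and §2 applies).
[cite: Balaban1985BackgroundPropagators, Thm 3.11 proof p.416 + (3.86) p.408] -/
theorem posDefEnd_of_perturbation {T₀ T₁ G₀ : Module.End ℝ (X → ℝ)} (hT₁ : IsTransposePair T₁ T₁) (hinv : T₀ * G₀ = 1)
    (hG₀ : ∀ v : X → ℝ, 0 ≤ v ⬝ᵥ G₀ v) {θ : ℝ} (hθ : θ < 1)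
    (hV : ∀ v : X → ℝ, -(v ⬝ᵥ (T₁ - T₀) (G₀ v)) ≤ θ * (v ⬝ᵥ v)) : PosDefEnd T₁ := by
  have hfac : T₁ * G₀ = 1 - (-((T₁ - T₀) * G₀)) := by
    rw [sub_neg_eq_add, ← hinv, ← add_mul, add_sub_cancel]
  refine posDefEnd_of_mul_eq_one_sub_of_psd hT₁ hfac hG₀ hθ fun v => ?_
  rw [LinearMap.neg_apply, dotProduct_neg, Module.End.mul_apply]
  exact hV v

omit [DecidableEq X] in
/-- **A TWO-SIDED INVERSE OF A POSITIVE DEFINITE OPERATOR IS POSITIVE DEFINITE** (no symmetry needed: `⟨v, Gv⟩ = ⟨TGv, Gv⟩ > 0` for `Gv ≠ 0`).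
[cite: Balaban1985BackgroundPropagators, Thm 3.11 p.416 («it is enough to prove it for G»), (3.27) p.395] -/
theorem posDefEnd_of_inverse {T G : Module.End ℝ (X → ℝ)} (hT : PosDefEnd T) (hTG : T * G = 1) : PosDefEnd G := by
  intro v hv
  have hv' : T (G v) = v := by rw [← Module.End.mul_apply, hTG, Module.End.one_apply]
  have hGv : G v ≠ 0 := fun h0 => hv (by rw [← hv', h0, map_zero])
  have h := hT (G v) hGv
  -- `⟨Gv, T(Gv)⟩ = ⟨Gv, v⟩ = ⟨v, Gv⟩`
  rw [hv', dotProduct_comm] at h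
  exact h

omit [DecidableEq X] in
/-- a two-sided inverse of a self-transpose operator is self-transpose (component pairing). [folklore] -/
private theorem isTransposePair_of_two_sided_inverse {T G : Module.End ℝ (X → ℝ)} (hT : IsTransposePair T T) (hTG : T * G = 1) :
    IsTransposePair G G := by
  intro u v
  have hu : T (G u) = u := by rw [← Module.End.mul_apply, hTG, Module.End.one_apply]
  have hv : T (G v) = v := by rw [← Module.End.mul_apply, hTG, Module.End.one_apply]
  have h := hT (G u) (G v)
  -- `Σ (T(Gu)) y · (Gv) y = Σ (Gu) x · (T(Gv)) x`, i.e. `Σ u · Gv = Σ Gu · v`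
  rw [hu, hv] at h
  calc ∑ y, G u y * v y = ∑ x, u x * G v x := by
        rw [← h]
    _ = ∑ x, u x * G v x := rfl

/-- ★★ **THE LOCAL CLAUSE OF `posDefEnd_deltaA_of_identities310` FOR ONE PROPAGATOR, BY PRINT'S ROAD**: a local propagator `G₁` that is the two-sided inverse of a
symmetric local operator `T₁` (`T₁·G₁ = 1 = G₁·T₁`, (3.27) for the local sequence), where `T₁` is a small perturbation — in the numerical-radius sense
`−⟨v, (T₁ − T₀)G₀v⟩ ≤ θ⟨v, v⟩`, `θ < 1` — of an operator `T₀` with a positive semi-definite right inverse `G₀` (print: `T₀ = Δ_□(1)`, `G₀ = G_□(1)` positive by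
[4], `T₁ = Δ_□(e^{iηA})`, `V(A) = T₁ − T₀`), IS symmetric and positive semi-definite: `IsTransposePair G₁ G₁ ∧ ∀ v, 0 ≤ ⟨v, G₁v⟩`.  (The gauge transformation to the
cube gauge `U = e^{iηA}` and the Sect. B smallness of `V(A)G_□(1)` are NOT here — they are the analytic input of this road.)
[cite: Balaban1985BackgroundPropagators, Thm 3.11 proof p.416 + (3.86) p.408 + Cor. 3.6 p.408] -/
theorem localClause_of_perturbation {T₀ T₁ G₀ G₁ : Module.End ℝ (X → ℝ)} (hT₁ : IsTransposePair T₁ T₁) (hinv₀ : T₀ * G₀ = 1)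
    (hG₀ : ∀ v : X → ℝ, 0 ≤ v ⬝ᵥ G₀ v) {θ : ℝ} (hθ : θ < 1)
    (hV : ∀ v : X → ℝ, -(v ⬝ᵥ (T₁ - T₀) (G₀ v)) ≤ θ * (v ⬝ᵥ v)) (hinv₁ : T₁ * G₁ = 1) :
    IsTransposePair G₁ G₁ ∧ ∀ v : X → ℝ, 0 ≤ v ⬝ᵥ G₁ v := by
  have hPD : PosDefEnd T₁ := posDefEnd_of_perturbation hT₁ hinv₀ hG₀ hθ hV
  refine ⟨isTransposePair_of_two_sided_inverse hT₁ hinv₁, fun v => ?_⟩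
  by_cases hv : v = 0
  · rw [hv, zero_dotProduct]
  · exact (posDefEnd_of_inverse hPD hinv₁ v hv).le

end LocalClause

end Literature.MathematicalPhysics.QuantumFieldTheory.Balaban1983to89.B9Thm311FromEq3105Schur

end
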